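import Summits.Ventures.HodgeRepro2.T6Host
import Summits.Ventures.HodgeRepro2.T6A2WeilGrading

/-!
# T6A2WeilLange — Lange's isomorphism in degrees 2 and 4 on the host's `ℂ ⊗ H^*(X(ℂ), ℚ)`

Cell pub-hodge-repro2, Tier 6 (README §10), seat t6-p2 (A2 owner); the binders `e2 / he2` (`alg_lefschetz_HC`)
and `e / he / h4` (`hostIdentW`, `splitWeilAlgebraic_of_periodN`) of t6-p1's T6A1HostBetti (STATUS l. 10992 (2)):
the degree-2 and degree-4 pieces of Lange–Birkenhake's `⋀ H¹ ≃ H^*` — the binder `hL : Function.Bijective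
(langeMap W P)`, from the display `Hyp.LangeBirkenhake1992_Prop1_1_20` (T6A2HypLange, ROAD A of STATUS l. 11151)
— on the HOST's rational Betti cohomology, base-changed to `ℂ` (`HC X i = ℂ ⊗[ℚ] H^i(X(ℂ), ℚ)`, `cupC11`, `cup4C`
of T6Host): over `ℚ` on any Weil cohomology `W`, `langeDeg W P hL n : ⋀[ℚ]^n H¹(X) ≃ₗ[ℚ] H^n(X)`,
`finrank_obj_eq_choose`, the `n`-fold cup product `cupAltW` as an alternating map spanning `H^n(X)`; transported
along `Bd.isoObj` (`iso_cup`): `cupAltQ`, `cupAltQ_two`, `cupAltQ_four`; on `HC`: a multilinear map agreeing with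
`1 ⊗ cupAltQ` on rational tuples is alternating (`M_eq_zero_of_eq`, `Basis.ext_multilinear`), and
`langeC Bd P M hM hL : ⋀[ℂ]^n (HC X 1) ≃ₗ[ℂ] HC X n` (surjective by rational spanning, bijective by the dimension
count `finrank_exteriorPower_HC`); hence **`lange2C`** (`e2`, on `cupC11`), **`lange4C`** (`e`, on `cup4C`) and
**`exists_eq_sum_cup4C`** (`h4`: a rational class of `ℂ ⊗ H⁴` is a `ℚ`-combination of four-fold cups of rational
classes of `ℂ ⊗ H¹`; rational = `LinearMap.range (TensorProduct.mk ℚ ℂ _ 1)` = t6-p1's `ratC`, an `abbrev`).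
No display is consumed here (the printed input enters as `hL`). No `sorry`; standard axioms.
§8(d): uses an L-value-free non-vanishing device: NO.
-/

noncomputable section

namespace Summit.Ventures.HodgeRepro2.T6.WeilLange

open HostAPI.Carriers.AlgebraicGeometry.Motives CategoryTheory Opposite WeilInst Host
open scoped TensorProduct DirectSum

universe u

/-! ## 1. The degree-`n` piece of Lange's isomorphism on a Weil cohomology (over `ℚ`) -/

section rational

variable {k : Type u} [Field k] (W : WeilCohomology k ℚ) (P : SPVar k)

/-- The degree-`n` Lange map `⋀^n H¹(X) → H^n(X)`: `t ↦ (langeMap t)_n`, its degree-`n` component. -/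
def langeDegMap (n : ℕ) : ⋀[ℚ]^n (W.obj P.X 1) →ₗ[ℚ] W.obj P.X n :=
  DirectSum.component ℚ ℕ (Full W P.X) n ∘ₗ (langeMap W P).toLinearMap ∘ₗ
    (⋀[ℚ]^n (W.obj P.X 1)).subtype

/-- `langeDegMap` is the degree-`n` component of `langeMap`. -/
theorem langeDegMap_apply (n : ℕ) (t : ⋀[ℚ]^n (W.obj P.X 1)) :
    langeDegMap W P n t = langeMap W P t n := rfl

/-- on `⋀^n H¹`, `langeMap` is `ofDegF n` of its degree-`n` component -/
theorem langeMap_eq_ofDegF (n : ℕ) (t : ⋀[ℚ]^n (W.obj P.X 1)) :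
    langeMap W P t = ofDegF W P n (langeDegMap W P n t) := by
  obtain ⟨y, hy⟩ := langeMap_mem_range_ofDegF W P t.2
  rw [langeDegMap_apply, ← hy, ofDegF_apply_same]

/-- the degree-`n` Lange map is injective when `langeMap` is -/
theorem langeDegMap_injective (hinj : Function.Injective (langeMap W P)) (n : ℕ) :
    Function.Injective (langeDegMap W P n) := by
  intro s t hst
  apply Subtype.ext
  apply hinj
  rw [langeMap_eq_ofDegF W P n s, langeMap_eq_ofDegF W P n t, hst]

/-- the degree-`n` Lange map is surjective when `langeMap` is bijective (the backward grading) -/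
theorem langeDegMap_surjective (hL : Function.Bijective (langeMap W P)) (n : ℕ) :
    Function.Surjective (langeDegMap W P n) := by
  intro y
  obtain ⟨t, ht⟩ := hL.2 (ofDegF W P n y)
  have htn : t ∈ ⋀[ℚ]^n (W.obj P.X 1) :=
    mem_exteriorPower_of_langeMap_mem W P hL.1 ⟨y, ht.symm⟩
  refine ⟨⟨t, htn⟩, ?_⟩
  rw [langeDegMap_apply]
  change langeMap W P t n = y
  rw [ht, ofDegF_apply_same]

/-- THE DEGREE-`n` LANGE ISOMORPHISM `⋀^n H¹(X) ≃ H^n(X)`, from the bijectivity of `langeMap`. -/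
def langeDeg (hL : Function.Bijective (langeMap W P)) (n : ℕ) :
    ⋀[ℚ]^n (W.obj P.X 1) ≃ₗ[ℚ] W.obj P.X n :=
  LinearEquiv.ofBijective (langeDegMap W P n)
    ⟨langeDegMap_injective W P hL.1 n, langeDegMap_surjective W P hL n⟩

/-- `langeDeg` is `langeDegMap` -/
theorem langeDeg_apply (hL : Function.Bijective (langeMap W P)) (n : ℕ) (t : ⋀[ℚ]^n (W.obj P.X 1)) :
    langeDeg W P hL n t = langeDegMap W P n t := rfl

/-- the dimension of `H^n(X)` is `C(dim H¹(X), n)` -/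
theorem finrank_obj_eq_choose (hL : Function.Bijective (langeMap W P)) (n : ℕ) :
    Module.finrank ℚ (W.obj P.X n) = (Module.finrank ℚ (W.obj P.X 1)).choose n := by
  haveI : Module.Finite ℚ (W.obj P.X 1) := W.finite_obj P.smooth 1
  rw [← (langeDeg W P hL n).finrank_eq, exteriorPower.finrank_eq]

/-- The `n`-fold cup product `(a₁, …, aₙ) ↦ a₁ ∪ ⋯ ∪ aₙ` on `H¹(X)` as an ALTERNATING map: the composite
of `ιMulti` with the degree-`n` Lange map (alternating by construction). -/
def cupAltW (n : ℕ) : (W.obj P.X 1) [⋀^Fin n]→ₗ[ℚ] W.obj P.X n :=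
  (langeDegMap W P n).compAlternatingMap (exteriorPower.ιMulti ℚ n)

/-- `cupAltW` is the degree-`n` component of `langeMap` of the exterior monomial -/
theorem cupAltW_apply (n : ℕ) (v : Fin n → W.obj P.X 1) :
    cupAltW W P n v = langeMap W P (ExteriorAlgebra.ιMulti ℚ n v) n := rfl

/-- the `n`-fold cup products of degree-one classes span `H^n(X)` -/
theorem span_range_cupAltW (hL : Function.Bijective (langeMap W P)) (n : ℕ) :
    Submodule.span ℚ (Set.range (cupAltW W P n)) = ⊤ := by
  have h1 : Set.range (cupAltW W P n) =
      langeDegMap W P n '' Set.range (exteriorPower.ιMulti ℚ n) := by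
    rw [← Set.range_comp]; rfl
  rw [h1, ← Submodule.map_span, exteriorPower.ιMulti_span, Submodule.map_top,
    LinearMap.range_eq_top.2 (langeDegMap_surjective W P hL n)]

/-- `ιMulti` of a pair is the product of the two generators -/
theorem ιMulti_two {M : Type*} [AddCommGroup M] [Module ℚ M] (v : Fin 2 → M) :
    ExteriorAlgebra.ιMulti ℚ 2 v = ExteriorAlgebra.ι ℚ (v 0) * ExteriorAlgebra.ι ℚ (v 1) := by
  rw [ExteriorAlgebra.ιMulti_apply]
  simp only [List.ofFn_succ, List.ofFn_zero, List.prod_cons, List.prod_nil, mul_one]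
  rfl

/-- `ιMulti` of a quadruple is the product of the four generators, bracketed as `(ab)(cd)` -/
theorem ιMulti_four {M : Type*} [AddCommGroup M] [Module ℚ M] (v : Fin 4 → M) :
    ExteriorAlgebra.ιMulti ℚ 4 v =
      (ExteriorAlgebra.ι ℚ (v 0) * ExteriorAlgebra.ι ℚ (v 1)) *
        (ExteriorAlgebra.ι ℚ (v 2) * ExteriorAlgebra.ι ℚ (v 3)) := by
  rw [ExteriorAlgebra.ιMulti_apply]
  simp only [List.ofFn_succ, List.ofFn_zero, List.prod_cons, List.prod_nil, mul_one]
  exact (mul_assoc _ _ _).symm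

/-- the two-fold cup product is the cup product -/
theorem cupAltW_two (v : Fin 2 → W.obj P.X 1) :
    cupAltW W P 2 v = W.cup (rfl : 1 + 1 = 2) (v 0) (v 1) := by
  rw [cupAltW_apply, ιMulti_two, map_mul, langeMap_ι, langeMap_ι, ι₁, ofDegF_mul_ofDegF]
  exact ofDegF_apply_same W P (1 + 1) _

/-- the four-fold cup product is `(a ∪ b) ∪ (c ∪ d)` -/
theorem cupAltW_four (v : Fin 4 → W.obj P.X 1) :
    cupAltW W P 4 v = W.cup (rfl : 2 + 2 = 2 * 2) (W.cup (rfl : 1 + 1 = 2) (v 0) (v 1))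
      (W.cup (rfl : 1 + 1 = 2) (v 2) (v 3)) := by
  rw [cupAltW_apply, ιMulti_four, map_mul, map_mul, map_mul, langeMap_ι, langeMap_ι, langeMap_ι,
    langeMap_ι, ι₁, ofDegF_mul_ofDegF, ofDegF_mul_ofDegF, ofDegF_mul_ofDegF]
  exact ofDegF_apply_same W P (1 + 1 + (1 + 1)) _

end rational

/-! ## 2. Transport to the host's rational Betti cohomology along `Bd.isoObj` -/

section betti

variable (Bd : BettiHodgeData ℂ) (P : SPVar ℂ)

/-- the `n`-fold cup product on `H¹(X(ℂ), ℚ)`, transported from `Bd.W` along `Bd.isoObj` -/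
def cupAltQ (n : ℕ) : (HQ P.X 1) [⋀^Fin n]→ₗ[ℚ] HQ P.X n :=
  (Bd.isoObj P.X n).toLinearMap.compAlternatingMap
    ((cupAltW Bd.W P n).compLinearMap (Bd.isoObj P.X 1).symm.toLinearMap)

/-- `cupAltQ` unfolded -/
theorem cupAltQ_apply (n : ℕ) (w : Fin n → HQ P.X 1) :
    cupAltQ Bd P n w = Bd.isoObj P.X n (cupAltW Bd.W P n fun j => (Bd.isoObj P.X 1).symm (w j)) := rfl

/-- `isoObj` is multiplicative (the host's `BettiHodgeData.iso_cup`, in the `isoObj` spelling) -/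
theorem isoObj_cup {p q n : ℕ} (h : p + q = n) (a : Bd.W.obj P.X p) (b : Bd.W.obj P.X q) :
    Bd.isoObj P.X n (Bd.W.cup h a b) = cupQ h (Bd.isoObj P.X p a) (Bd.isoObj P.X q b) :=
  Bd.iso_cup P.X h a b

/-- the two-fold cup product on `H¹(X(ℂ), ℚ)` is the host's cup product -/
theorem cupAltQ_two (w : Fin 2 → HQ P.X 1) :
    cupAltQ Bd P 2 w = cupQ (rfl : 1 + 1 = 2) (w 0) (w 1) := by
  rw [cupAltQ_apply, cupAltW_two, isoObj_cup, LinearEquiv.apply_symm_apply,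
    LinearEquiv.apply_symm_apply]

/-- the four-fold cup product on `H¹(X(ℂ), ℚ)` is `(a ∪ b) ∪ (c ∪ d)` for the host's cup product -/
theorem cupAltQ_four (w : Fin 4 → HQ P.X 1) :
    cupAltQ Bd P 4 w = cupQ (rfl : 2 + 2 = 2 * 2) (cupQ (rfl : 1 + 1 = 2) (w 0) (w 1))
      (cupQ (rfl : 1 + 1 = 2) (w 2) (w 3)) := by
  rw [cupAltQ_apply, cupAltW_four, isoObj_cup, isoObj_cup, isoObj_cup, LinearEquiv.apply_symm_apply,
    LinearEquiv.apply_symm_apply, LinearEquiv.apply_symm_apply, LinearEquiv.apply_symm_apply]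

/-- the `n`-fold cup products of degree-one classes span `H^n(X(ℂ), ℚ)` -/
theorem span_range_cupAltQ (hL : Function.Bijective (langeMap Bd.W P)) (n : ℕ) :
    Submodule.span ℚ (Set.range (cupAltQ Bd P n)) = ⊤ := by
  have h1 : Set.range (cupAltQ Bd P n) = Bd.isoObj P.X n '' Set.range (cupAltW Bd.W P n) := by
    ext y
    constructor
    · rintro ⟨w, rfl⟩
      exact ⟨_, ⟨_, rfl⟩, rfl⟩
    · rintro ⟨_, ⟨v, rfl⟩, rfl⟩
      refine ⟨fun j => Bd.isoObj P.X 1 (v j), ?_⟩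
      rw [cupAltQ_apply]
      congr 2
      funext j
      exact LinearEquiv.symm_apply_apply _ _
  rw [h1, ← LinearEquiv.coe_coe, ← Submodule.map_span, span_range_cupAltW Bd.W P hL n,
    Submodule.map_top, LinearEquiv.range]

include Bd in
/-- `H^n(X(ℂ), ℚ)` is finite-dimensional (the host's `finite_obj`, transported) -/
theorem finite_HQ (n : ℕ) : Module.Finite ℚ (HQ P.X n) :=
  haveI := Bd.W.finite_obj P.smooth n
  Module.Finite.equiv (Bd.isoObj P.X n)

/-- the dimension of `H^n(X(ℂ), ℚ)` is `C(dim H¹, n)` -/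
theorem finrank_HQ_eq_choose (hL : Function.Bijective (langeMap Bd.W P)) (n : ℕ) :
    Module.finrank ℚ (HQ P.X n) = (Module.finrank ℚ (HQ P.X 1)).choose n := by
  rw [← (Bd.isoObj P.X n).finrank_eq, ← (Bd.isoObj P.X 1).finrank_eq, finrank_obj_eq_choose Bd.W P hL n]

end betti

/-! ## 3. The complexification: an alternating multilinear map on `HC X 1` and Lange's isomorphism -/

section complex

variable (Bd : BettiHodgeData ℂ) (P : SPVar ℂ) {n : ℕ}
  (M : MultilinearMap ℂ (fun _ : Fin n => HC P.X 1) (HC P.X n))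
  (hM : ∀ w : Fin n → HQ P.X 1, M (fun j => (1 : ℂ) ⊗ₜ[ℚ] w j) = (1 : ℂ) ⊗ₜ[ℚ] cupAltQ Bd P n w)

include hM in
/-- the swap identity on `HC`, transported from the alternating `cupAltQ` through a rational basis -/
theorem M_comp_swap (i j : Fin n) (hij : i ≠ j) (v : Fin n → HC P.X 1) :
    M (v ∘ Equiv.swap i j) = -M v := by
  classical
  let b := Module.Free.chooseBasis ℚ (HQ P.X 1)
  have key : M.domDomCongr (Equiv.swap i j) = -M := by
    refine Module.Basis.ext_multilinear (fun _ => b.baseChange ℂ) fun u => ?_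
    simp only [MultilinearMap.domDomCongr_apply, neg_apply, Module.Basis.baseChange_apply]
    rw [hM, hM, ← TensorProduct.tmul_neg]
    congr 1
    exact (cupAltQ Bd P n).map_swap (fun k => b (u k)) hij
  exact DFunLike.congr_fun key v

include hM in
/-- `M` vanishes on a tuple with two equal entries: it is alternating -/
theorem M_eq_zero_of_eq (v : Fin n → HC P.X 1) (i j : Fin n) (h : v i = v j) (hij : i ≠ j) :
    M v = 0 := by
  have h1 : v ∘ Equiv.swap i j = v := by
    funext x
    simp only [Function.comp_apply, Equiv.swap_apply_def]
    split_ifs with hx hx'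
    · rw [hx, h]
    · rw [hx', h]
    · rfl
  have h2 := M_comp_swap Bd P M hM i j hij v
  rw [h1] at h2
  have h3 : (2 : ℂ) • M v = 0 := by
    rw [two_smul]
    exact add_eq_zero_iff_eq_neg.2 h2
  exact (smul_eq_zero.1 h3).resolve_left two_ne_zero

/-- the alternating map on `HC X 1` underlying `M` -/
def altC : (HC P.X 1) [⋀^Fin n]→ₗ[ℂ] HC P.X n :=
  { M with map_eq_zero_of_eq' := fun v i j h hij => M_eq_zero_of_eq Bd P M hM v i j h hij }

/-- `altC` is `M` -/
theorem altC_apply (v : Fin n → HC P.X 1) : altC Bd P M hM v = M v := rfl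

/-- the linear map `⋀[ℂ]^n (HC X 1) → HC X n` induced by `M` -/
def langeCMap : ⋀[ℂ]^n (HC P.X 1) →ₗ[ℂ] HC P.X n :=
  exteriorPower.alternatingMapLinearEquiv (altC Bd P M hM)

/-- `langeCMap` on exterior monomials is `M` -/
theorem langeCMap_ιMulti (v : Fin n → HC P.X 1) :
    langeCMap Bd P M hM (exteriorPower.ιMulti ℂ n v) = M v :=
  exteriorPower.alternatingMapLinearEquiv_apply_ιMulti _ _

include hM in
/-- `langeCMap` is surjective: `HC X n` is spanned by the rational classes `1 ⊗ x`, and every `x ∈ H^n(X, ℚ)`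
is a combination of `n`-fold cup products of degree-one classes -/
theorem langeCMap_surjective (hL : Function.Bijective (langeMap Bd.W P)) :
    Function.Surjective (langeCMap Bd P M hM) := by
  rw [← LinearMap.range_eq_top, eq_top_iff, ← Submodule.baseChange_top (A := ℂ) (M := HQ P.X n),
    Submodule.baseChange_eq_span, Submodule.span_le]
  rintro _ ⟨x, -, rfl⟩
  have hx : x ∈ Submodule.span ℚ (Set.range (cupAltQ Bd P n)) := by
    rw [span_range_cupAltQ Bd P hL n]; trivial
  refine Submodule.span_induction
    (p := fun x _ => TensorProduct.mk ℚ ℂ (HQ P.X n) 1 x ∈ LinearMap.range (langeCMap Bd P M hM))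
    ?_ ?_ ?_ ?_ hx
  · rintro _ ⟨w, rfl⟩
    exact ⟨exteriorPower.ιMulti ℂ n (fun j => (1 : ℂ) ⊗ₜ[ℚ] w j), by rw [langeCMap_ιMulti, hM]; rfl⟩
  · simp
  · intro a b _ _ ha hb
    rw [map_add]
    exact Submodule.add_mem _ ha hb
  · intro q a _ ha
    rw [map_smul]
    exact Submodule.smul_of_tower_mem _ q ha

include Bd in
/-- `HC X i` is finite-dimensional over `ℂ` -/
theorem finite_HC (i : ℕ) : Module.Finite ℂ (HC P.X i) :=
  haveI := finite_HQ Bd P i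
  inferInstance

/-- the dimension count: `⋀[ℂ]^n (HC X 1)` and `HC X n` have the same dimension -/
theorem finrank_exteriorPower_HC (hL : Function.Bijective (langeMap Bd.W P)) :
    Module.finrank ℂ (⋀[ℂ]^n (HC P.X 1)) = Module.finrank ℂ (HC P.X n) := by
  haveI := finite_HQ Bd P 1
  haveI := finite_HC Bd P 1
  rw [exteriorPower.finrank_eq, Module.finrank_baseChange, Module.finrank_baseChange,
    finrank_HQ_eq_choose Bd P hL n]

include hM in
/-- `langeCMap` is bijective -/
theorem langeCMap_bijective (hL : Function.Bijective (langeMap Bd.W P)) :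
    Function.Bijective (langeCMap Bd P M hM) := by
  haveI := finite_HQ Bd P 1
  haveI := finite_HC Bd P 1
  haveI := finite_HC Bd P n
  have hs := langeCMap_surjective Bd P M hM hL
  exact ⟨(LinearMap.injective_iff_surjective_of_finrank_eq_finrank
    (finrank_exteriorPower_HC Bd P hL)).2 hs, hs⟩

/-- LANGE'S ISOMORPHISM IN DEGREE `n` ON THE COMPLEXIFIED BETTI COHOMOLOGY `⋀[ℂ]^n (HC X 1) ≃ HC X n`. -/
def langeC (hL : Function.Bijective (langeMap Bd.W P)) : ⋀[ℂ]^n (HC P.X 1) ≃ₗ[ℂ] HC P.X n :=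
  LinearEquiv.ofBijective (langeCMap Bd P M hM) (langeCMap_bijective Bd P M hM hL)

/-- `langeC` on exterior monomials is `M` -/
theorem langeC_ιMulti (hL : Function.Bijective (langeMap Bd.W P)) (v : Fin n → HC P.X 1) :
    langeC Bd P M hM hL (exteriorPower.ιMulti ℂ n v) = M v :=
  langeCMap_ιMulti Bd P M hM v

end complex

/-! ## 4. Degrees 2 and 4 in the lead's vocabulary: `cupC11`, `cup4C` -/

section instances

variable (Bd : BettiHodgeData ℂ) (P : SPVar ℂ)

/-- the two-fold cup product `cupC11` as a multilinear map on `HC X 1` -/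
def cupMC2 : MultilinearMap ℂ (fun _ : Fin 2 => HC P.X 1) (HC P.X 2) :=
  ((TensorProduct.lift (cupC11 P.X)).compMultilinearMap
    ((MultilinearMap.ofSubsingleton ℂ (HC P.X 1) (HC P.X 1) (0 : Fin 1) LinearMap.id).domCoprod
      (MultilinearMap.ofSubsingleton ℂ (HC P.X 1) (HC P.X 1) (0 : Fin 1) LinearMap.id))).domDomCongr
    finSumFinEquiv

/-- `cupMC2` unfolded -/
theorem cupMC2_apply (v : Fin 2 → HC P.X 1) : cupMC2 P v = cupC11 P.X (v 0) (v 1) := rfl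

/-- `cupMC2` on rational tuples is `1 ⊗ (cup product)` -/
theorem cupMC2_tmul (w : Fin 2 → HQ P.X 1) :
    cupMC2 P (fun j => (1 : ℂ) ⊗ₜ[ℚ] w j) = (1 : ℂ) ⊗ₜ[ℚ] cupAltQ Bd P 2 w := by
  rw [cupMC2_apply, cupAltQ_two, cupC11, LinearMap.BilinMap.baseChange_tmul, one_mul]

/-- the four-fold cup product `cup4C` as a multilinear map on `HC X 1` -/
def cupMC4 : MultilinearMap ℂ (fun _ : Fin 4 => HC P.X 1) (HC P.X (2 * 2)) :=
  ((TensorProduct.lift (cupC22 P.X)).compMultilinearMap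
    ((cupMC2 P).domCoprod (cupMC2 P))).domDomCongr finSumFinEquiv

/-- `cupMC4` unfolded -/
theorem cupMC4_apply (v : Fin 4 → HC P.X 1) : cupMC4 P v = cup4C (v 0) (v 1) (v 2) (v 3) := rfl

/-- `cupMC4` on rational tuples is `1 ⊗ ((a ∪ b) ∪ (c ∪ d))` -/
theorem cupMC4_tmul (w : Fin 4 → HQ P.X 1) :
    cupMC4 P (fun j => (1 : ℂ) ⊗ₜ[ℚ] w j) = (1 : ℂ) ⊗ₜ[ℚ] cupAltQ Bd P 4 w := by
  rw [cupMC4_apply, cupAltQ_four, cup4C, cupC11, cupC22, LinearMap.BilinMap.baseChange_tmul,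
    LinearMap.BilinMap.baseChange_tmul, one_mul, LinearMap.BilinMap.baseChange_tmul, one_mul]

/-- **LANGE IN DEGREE 2 ON `HC`** (t6-p1's `e2`): `⋀[ℂ]^2 (HC X 1) ≃ₗ[ℂ] HC X 2` on `cupC11`. -/
def lange2C (hL : Function.Bijective (langeMap Bd.W P)) : ⋀[ℂ]^2 (HC P.X 1) ≃ₗ[ℂ] HC P.X 2 :=
  langeC Bd P (cupMC2 P) (cupMC2_tmul Bd P) hL

/-- t6-p1's `he2`: `lange2C` sends `a ∧ b` to `cupC11 a b` -/
theorem lange2C_ιMulti (hL : Function.Bijective (langeMap Bd.W P)) (v : Fin 2 → HC P.X 1) :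
    lange2C Bd P hL (exteriorPower.ιMulti ℂ 2 v) = cupC11 P.X (v 0) (v 1) :=
  langeC_ιMulti Bd P (cupMC2 P) (cupMC2_tmul Bd P) hL v

/-- **LANGE IN DEGREE 4 ON `HC`** (t6-p1's `e`): `⋀[ℂ]^4 (HC X 1) ≃ₗ[ℂ] HC X (2 * 2)` on `cup4C`. -/
def lange4C (hL : Function.Bijective (langeMap Bd.W P)) : ⋀[ℂ]^4 (HC P.X 1) ≃ₗ[ℂ] HC P.X (2 * 2) :=
  langeC Bd P (cupMC4 P) (cupMC4_tmul Bd P) hL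

/-- t6-p1's `he`: `lange4C` sends `a ∧ b ∧ c ∧ d` to `cup4C a b c d` -/
theorem lange4C_ιMulti (hL : Function.Bijective (langeMap Bd.W P)) (v : Fin 4 → HC P.X 1) :
    lange4C Bd P hL (exteriorPower.ιMulti ℂ 4 v) = cup4C (v 0) (v 1) (v 2) (v 3) :=
  langeC_ιMulti Bd P (cupMC4 P) (cupMC4_tmul Bd P) hL v

/-- a rational scalar acts on `HC` through its cast to `ℂ` -/
theorem ratCast_smul {X : SchemeOver ℂ} {i : ℕ} (q : ℚ) (y : HC X i) : (q : ℂ) • y = q • y :=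
  Rat.cast_smul_eq_qsmul ℂ q y

/-- **THE DEGREE-4 RATIONALITY CLAUSE** (t6-p1's `h4`): a rational class of `ℂ ⊗ H⁴(X(ℂ), ℚ)` (an element of
`LinearMap.range (TensorProduct.mk ℚ ℂ _ 1)` = t6-p1's `ratC`) is a `ℚ`-combination of four-fold cup products
`cup4C` of rational classes of `ℂ ⊗ H¹(X(ℂ), ℚ)` — Lange's isomorphism in degree 4 over `ℚ`. -/
theorem exists_eq_sum_cup4C (hL : Function.Bijective (langeMap Bd.W P)) (c : HC P.X (2 * 2))
    (hc : c ∈ LinearMap.range (TensorProduct.mk ℚ ℂ (HQ P.X (2 * 2)) 1)) :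
    ∃ (m : ℕ) (q : Fin m → ℚ) (r : Fin m → Fin 4 → HC P.X 1),
      (∀ i j, r i j ∈ LinearMap.range (TensorProduct.mk ℚ ℂ (HQ P.X 1) 1)) ∧
        c = ∑ i, (q i : ℂ) • cup4C (r i 0) (r i 1) (r i 2) (r i 3) := by
  obtain ⟨x, rfl⟩ := hc
  have hx : x ∈ Submodule.span ℚ (Set.range (cupAltQ Bd P 4)) := by
    rw [span_range_cupAltQ Bd P hL 4]; trivial
  obtain ⟨m, q, g, hg⟩ := Submodule.mem_span_set'.1 hx
  choose w hw using fun i => (g i).2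
  refine ⟨m, q, fun i j => (1 : ℂ) ⊗ₜ[ℚ] w i j, fun i j => ⟨w i j, rfl⟩, ?_⟩
  rw [TensorProduct.mk_apply, ← hg, TensorProduct.tmul_sum]
  refine Finset.sum_congr rfl fun i _ => ?_
  rw [TensorProduct.tmul_smul, ← ratCast_smul, ← hw i]
  congr 1
  exact (cupMC4_tmul Bd P (w i)).symm

end instances

end Summit.Ventures.HodgeRepro2.T6.WeilLange

end
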